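import Summits.CriticalPhenomena.PercolationContinuityZ3.Theorems.PercNearOneGluingNoHeavyQuantCombTails
import Literature.Probability.LatticeModels.ProdBernoulliClusterLocality
import HarnessLib

/-!
# QUANT lane R8 — moving a hair of a comb to the root (the TOP endpoint of the relocation lemma)

builds on p205010 (kernel theorem, internal audit signed; external expert review pending)

Support file (`--supports stmt-CriticalPhenomena-4575`), QUANT lane lead (gen 9), rung R8 of `run/shared/lean/prim/quant/LADDER.md`;
memo `prim-quant-lead-g9/LEAD-NOTES-G9.md` N20 step (4) — sixth file of the kernel proof of FAR (`Quant.FarTreeRow`) at EVERY layer on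
COMBS.  Setting of `…QuantCombLevels.lean` / `…QuantCombTails.lean` (ancestor finsets `P`, gates `q`, relays `A`, distinguished relay `a`
with spine `P a`).  A hair `b ∈ A` (`b ∉ P a`, `b ∈ P b`) is MOVED TO THE ROOT: its prefix becomes its private part `P b ∖ P a` and its
gates are rescaled so that its marginal is unchanged (`∏_{P b ∖ P a} q' = ∏_{P b} q`, `q' = q` off `b`); nothing else changes.
Theorems only; no sorries; standard axioms.

* `Quant.comb_top_light_eq` — **the cost of the top endpoint**: under the moved configuration
  `P'(#{z ∈ A | P' z open} ≤ j) = P(#{z ∈ A ∖ b | P z open} ≤ j) − T_b · e_0`, `e_0 = P(#{z ∈ A ∖ b | P z open} = j)`.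
* `Quant.comb_top_spine`, `Quant.comb_top_downClosed`, `Quant.comb_top_private_disjoint`, `Quant.comb_top_marginal`,
  `Quant.comb_top_measure` — the comb hypotheses survive the move, every marginal and the mean are unchanged, and the number of hairs
  attached at a positive level drops by one.
[this work]
-/

noncomputable section

namespace Summit.CriticalPhenomena.PercolationContinuityZ3.Theorems

namespace Quant

open Finset MeasureTheory
open Literature.Probability.LatticeModels
open Literature.Probability.Percolation
open scoped Classical

variable {ι : Type*} [Fintype ι]

omit [Fintype ι] in
/-- In a comb, the tip `b` of a hair lies in no other relay's prefix and not on the spine side of anything. [this work] -/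
theorem comb_hair_tip_notMem (P : ι → Finset ι) (a : ι) (A : Finset ι) {b : ι} (hbA : b ∈ A) (hba : b ∉ P a) (hbb : b ∈ P b)
    (hA6 : ∀ z ∈ A, ∀ z' ∈ A, z ≠ z' → Disjoint (P z \ P a) (P z' \ P a)) {z : ι} (hz : z ∈ A) (hzb : z ≠ b) : b ∉ P z := by
  intro h
  have h1 : b ∈ P z \ P a := Finset.mem_sdiff.2 ⟨h, hba⟩
  have h2 : b ∈ P b \ P a := Finset.mem_sdiff.2 ⟨hbb, hba⟩
  exact Finset.disjoint_left.1 (hA6 z hz b hbA hzb) h1 h2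

/-- **The cost of the top endpoint.**  Move the hair `b` to the root (`P' b = P b ∖ P a`, `P' = P` elsewhere, `q' = q` off `b`,
`∏_{P b ∖ P a} q' = ∏_{P b} q`).  Then `P_{q'}(#{z ∈ A | P' z open} ≤ j) = P_q(#{z ∈ A ∖ b | P z open} ≤ j) − (∏_{P b} q)·e_0` with
`e_0 = P_q(#{z ∈ A ∖ b | P z open} = j ∧ S 0 open)` (`S 0 = ∅`). [this work] -/
theorem comb_top_light_eq (q q' : ι → unitInterval) (P P' : ι → Finset ι) (a : ι) (A : Finset ι) (j : ℕ) {b : ι}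
    (hsp : ∀ y ∈ P a, y ∈ P y ∧ P y ⊆ P a ∧ ∀ y' ∈ P a,
      (y ∈ P y' ∨ y' ∈ P y) ∧ (y ∈ P y' → P y ⊆ P y') ∧ (y ∈ P y' → y' ∈ P y → y = y'))
    (hA5 : ∀ z ∈ A, ∀ y ∈ P z, y ∈ P a → P y ⊆ P z)
    (hA6 : ∀ z ∈ A, ∀ z' ∈ A, z ≠ z' → Disjoint (P z \ P a) (P z' \ P a))
    (hbA : b ∈ A) (hba : b ∉ P a) (hbb : b ∈ P b)
    (hP'b : P' b = P b \ P a) (hP' : ∀ x, x ≠ b → P' x = P x) (hq' : ∀ i, i ≠ b → q' i = q i)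
    (hq'T : ∏ y ∈ P b \ P a, (q' y : ℝ) = ∏ y ∈ P b, (q y : ℝ)) :
    (prodBernoulli q').real {ω : Set ι | (A.filter fun z => ((P' z : Finset ι) : Set ι) ⊆ ω).card ≤ j} =
      (prodBernoulli q).real {ω : Set ι | ((A.erase b).filter fun z => ((P z : Finset ι) : Set ι) ⊆ ω).card ≤ j} -
        (∏ y ∈ P b, (q y : ℝ)) *
          (prodBernoulli q).real {ω : Set ι | ((A.erase b).filter fun z => ((P z : Finset ι) : Set ι) ⊆ ω).card = j ∧
            (((P a).filter (fun y => (P y).card ≤ 0) : Finset ι) : Set ι) ⊆ ω} := by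
  have hmeas : ∀ T : Set (Set ι), MeasurableSet T := fun T => (Set.toFinite T).measurableSet
  have hab : a ≠ b := fun h => hba (by rw [h]; exact hbb)
  have hP'a : P' a = P a := hP' a hab
  -- the spine and the other relays are untouched
  have hsp' : ∀ y ∈ P' a, y ∈ P' y ∧ P' y ⊆ P' a ∧ ∀ y' ∈ P' a,
      (y ∈ P' y' ∨ y' ∈ P' y) ∧ (y ∈ P' y' → P' y ⊆ P' y') ∧ (y ∈ P' y' → y' ∈ P' y → y = y') := by
    intro y hy
    rw [hP'a] at hy
    have hyb : y ≠ b := fun h => hba (h ▸ hy)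
    rw [hP'a, hP' y hyb]
    obtain ⟨h1, h2, h3⟩ := hsp y hy
    refine ⟨h1, h2, fun y' hy' => ?_⟩
    have hy'b : y' ≠ b := fun h => hba (h ▸ hy')
    rw [hP' y' hy'b]
    exact h3 y' hy'
  have hA5' : ∀ z ∈ A.erase b, ∀ y ∈ P' z, y ∈ P' a → P' y ⊆ P' z := by
    intro z hz y hy hya
    have hzb : z ≠ b := Finset.ne_of_mem_erase hz
    rw [hP' z hzb] at hy ⊢
    rw [hP'a] at hya
    rw [hP' y (fun h => hba (h ▸ hya))]
    exact hA5 z (Finset.mem_of_mem_erase hz) y hy hya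
  have hbdown : ∀ y ∈ P' b, y ∈ P' a → P' y ⊆ P' b := by
    intro y hy hya
    rw [hP'b, Finset.mem_sdiff] at hy
    rw [hP'a] at hya
    exact absurd hya hy.2
  have hbdisj : ∀ z ∈ A.erase b, Disjoint (P' z \ P' a) (P' b \ P' a) := by
    intro z hz
    have hzb : z ≠ b := Finset.ne_of_mem_erase hz
    rw [hP' z hzb, hP'a, hP'b, sdiff_sdiff_left, sup_idem]
    exact hA6 z (Finset.mem_of_mem_erase hz) b hbA hzb
  have key := comb_hair_conditioning q' P' a (A.erase b) j (Finset.notMem_erase b A) hsp' hA5' hbdown hbdisj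
  rw [Finset.insert_erase hbA] at key
  rw [key]
  -- identify the three pieces with the un-primed ones
  have hlev : (P' b ∩ P' a).card = 0 := by
    rw [hP'b, hP'a, Finset.card_eq_zero, ← Finset.disjoint_iff_inter_eq_empty]; exact Finset.sdiff_disjoint
  have hS0 : (P' a).filter (fun y => (P' y).card ≤ (P' b ∩ P' a).card) = (P a).filter (fun y => (P y).card ≤ 0) := by
    rw [hlev, hP'a]
    refine Finset.filter_congr fun y hy => ?_
    rw [hP' y (fun h => hba (h ▸ hy))]
  have hQ : P' b \ P' a = P b \ P a := by rw [hP'b, hP'a, sdiff_sdiff_left, sup_idem]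
  have hfilt : ∀ ω : Set ι, ((A.erase b).filter fun z => ((P' z : Finset ι) : Set ι) ⊆ ω) =
      ((A.erase b).filter fun z => ((P z : Finset ι) : Set ι) ⊆ ω) := fun ω =>
    Finset.filter_congr fun z hz => by rw [hP' z (Finset.ne_of_mem_erase hz)]
  -- the un-primed events are determined by coordinates off `b`, where `q' = q`
  set G : Finset ι := (A.erase b).biUnion P ∪ P a with hG
  have hbG : b ∉ G := by
    rw [hG, Finset.mem_union, Finset.mem_biUnion, not_or]
    refine ⟨?_, hba⟩
    rintro ⟨z, hz, hbz⟩
    exact comb_hair_tip_notMem P a A hbA hba hbb hA6 (Finset.mem_of_mem_erase hz) (Finset.ne_of_mem_erase hz) hbz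
  have hqG : ∀ i ∈ (↑G : Set ι), q' i = q i := fun i hi => hq' i (fun h => hbG (h ▸ Finset.mem_coe.1 hi))
  have dL : ∀ Φ : ℕ → Prop, DeterminedBy {ω : Set ι | Φ (((A.erase b).filter fun z => ((P z : Finset ι) : Set ι) ⊆ ω).card)} (↑G : Set ι) :=
    fun Φ => (determinedBy_card_filter_open (A.erase b) P ((A.erase b).biUnion P)
      (fun z hz => Finset.subset_biUnion_of_mem P hz) Φ).mono (by rw [hG]; exact Finset.coe_subset.2 Finset.subset_union_left)
  have dS : DeterminedBy {ω : Set ι | (((P a).filter (fun y => (P y).card ≤ 0) : Finset ι) : Set ι) ⊆ ω} (↑G : Set ι) :=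
    (determinedBy_subset_open _).mono (Finset.coe_subset.2 ((Finset.filter_subset _ _).trans
      (by rw [hG]; exact Finset.subset_union_right)))
  have e1 : (prodBernoulli q').real {ω : Set ι | ((A.erase b).filter fun z => ((P' z : Finset ι) : Set ι) ⊆ ω).card ≤ j} =
      (prodBernoulli q).real {ω : Set ι | ((A.erase b).filter fun z => ((P z : Finset ι) : Set ι) ⊆ ω).card ≤ j} := by
    simp only [hfilt]
    exact prodBernoulli_real_eq_of_determinedBy q' q hqG (dL fun c => c ≤ j) (hmeas _)
  have e2 : (prodBernoulli q').real {ω : Set ι | ((A.erase b).filter fun z => ((P' z : Finset ι) : Set ι) ⊆ ω).card = j ∧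
        (((P' a).filter (fun y => (P' y).card ≤ (P' b ∩ P' a).card) : Finset ι) : Set ι) ⊆ ω} =
      (prodBernoulli q).real {ω : Set ι | ((A.erase b).filter fun z => ((P z : Finset ι) : Set ι) ⊆ ω).card = j ∧
        (((P a).filter (fun y => (P y).card ≤ 0) : Finset ι) : Set ι) ⊆ ω} := by
    simp only [hfilt, hS0]
    have : {ω : Set ι | ((A.erase b).filter fun z => ((P z : Finset ι) : Set ι) ⊆ ω).card = j ∧
        (((P a).filter (fun y => (P y).card ≤ 0) : Finset ι) : Set ι) ⊆ ω} =
        {ω : Set ι | ((A.erase b).filter fun z => ((P z : Finset ι) : Set ι) ⊆ ω).card = j} ∩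
          {ω | (((P a).filter (fun y => (P y).card ≤ 0) : Finset ι) : Set ι) ⊆ ω} := by ext ω; simp
    rw [this]
    exact prodBernoulli_real_eq_of_determinedBy q' q hqG ((dL fun c => c = j).inter dS) (hmeas _)
  rw [e1, e2, hQ, hq'T]

/-! ### The comb hypotheses survive the move -/

omit [Fintype ι] in
/-- The spine is untouched by the move. [this work] -/
theorem comb_top_spine (P P' : ι → Finset ι) (a : ι) {b : ι} (hba : b ∉ P a) (hbb : b ∈ P b)
    (hP' : ∀ x, x ≠ b → P' x = P x)
    (hsp : ∀ y ∈ P a, y ∈ P y ∧ P y ⊆ P a ∧ ∀ y' ∈ P a,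
      (y ∈ P y' ∨ y' ∈ P y) ∧ (y ∈ P y' → P y ⊆ P y') ∧ (y ∈ P y' → y' ∈ P y → y = y')) :
    P' a = P a ∧ (∀ y ∈ P a, P' y = P y) ∧ ∀ y ∈ P' a, y ∈ P' y ∧ P' y ⊆ P' a ∧ ∀ y' ∈ P' a,
      (y ∈ P' y' ∨ y' ∈ P' y) ∧ (y ∈ P' y' → P' y ⊆ P' y') ∧ (y ∈ P' y' → y' ∈ P' y → y = y') := by
  have hab : a ≠ b := fun h => hba (by rw [h]; exact hbb)
  have hP'a : P' a = P a := hP' a hab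
  have hP'y : ∀ y ∈ P a, P' y = P y := fun y hy => hP' y (fun h => hba (h ▸ hy))
  refine ⟨hP'a, hP'y, fun y hy => ?_⟩
  rw [hP'a] at hy
  rw [hP'a, hP'y y hy]
  obtain ⟨h1, h2, h3⟩ := hsp y hy
  refine ⟨h1, h2, fun y' hy' => ?_⟩
  rw [hP'y y' hy']
  exact h3 y' hy'

omit [Fintype ι] in
/-- Down-closedness of the spine parts, disjointness of the private parts and "every relay owns its tip" survive the move. [this work] -/
theorem comb_top_relays (P P' : ι → Finset ι) (a : ι) (A : Finset ι) {b : ι} (hbA : b ∈ A) (hba : b ∉ P a) (hbb : b ∈ P b)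
    (hP'b : P' b = P b \ P a) (hP' : ∀ x, x ≠ b → P' x = P x)
    (hA5 : ∀ z ∈ A, ∀ y ∈ P z, y ∈ P a → P y ⊆ P z)
    (hA6 : ∀ z ∈ A, ∀ z' ∈ A, z ≠ z' → Disjoint (P z \ P a) (P z' \ P a))
    (hA8 : ∀ z ∈ A, z ∈ P z) :
    (∀ z ∈ A, P' z \ P' a = P z \ P a) ∧
    (∀ z ∈ A, ∀ y ∈ P' z, y ∈ P' a → P' y ⊆ P' z) ∧
    (∀ z ∈ A, ∀ z' ∈ A, z ≠ z' → Disjoint (P' z \ P' a) (P' z' \ P' a)) ∧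
    (∀ z ∈ A, z ∈ P' z) := by
  have hab : a ≠ b := fun h => hba (by rw [h]; exact hbb)
  have hP'a : P' a = P a := hP' a hab
  have hQ : ∀ z ∈ A, P' z \ P' a = P z \ P a := by
    intro z hz
    rw [hP'a]
    by_cases hzb : z = b
    · subst hzb; rw [hP'b, sdiff_sdiff_left, sup_idem]
    · rw [hP' z hzb]
  refine ⟨hQ, ?_, ?_, ?_⟩
  · intro z hz y hy hya
    rw [hP'a] at hya
    by_cases hzb : z = b
    · subst hzb; rw [hP'b, Finset.mem_sdiff] at hy; exact absurd hya hy.2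
    · rw [hP' z hzb] at hy ⊢
      rw [hP' y (fun h => hba (h ▸ hya))]
      exact hA5 z hz y hy hya
  · intro z hz z' hz' hne
    rw [hQ z hz, hQ z' hz']
    exact hA6 z hz z' hz' hne
  · intro z hz
    by_cases hzb : z = b
    · subst hzb; rw [hP'b, Finset.mem_sdiff]; exact ⟨hbb, hba⟩
    · rw [hP' z hzb]; exact hA8 z hz

omit [Fintype ι] in
/-- Every marginal (hence the least one and the mean) is unchanged by the move. [this work] -/
theorem comb_top_marginal (q q' : ι → unitInterval) (P P' : ι → Finset ι) (a : ι) (A : Finset ι) {b : ι}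
    (hbA : b ∈ A) (hba : b ∉ P a) (hbb : b ∈ P b)
    (hP'b : P' b = P b \ P a) (hP' : ∀ x, x ≠ b → P' x = P x) (hq' : ∀ i, i ≠ b → q' i = q i)
    (hq'T : ∏ y ∈ P b \ P a, (q' y : ℝ) = ∏ y ∈ P b, (q y : ℝ))
    (hA6 : ∀ z ∈ A, ∀ z' ∈ A, z ≠ z' → Disjoint (P z \ P a) (P z' \ P a)) :
    (∏ y ∈ P' a, (q' y : ℝ)) = ∏ y ∈ P a, (q y : ℝ) ∧ ∀ z ∈ A, (∏ y ∈ P' z, (q' y : ℝ)) = ∏ y ∈ P z, (q y : ℝ) := by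
  have hab : a ≠ b := fun h => hba (by rw [h]; exact hbb)
  have hprod : ∀ S : Finset ι, b ∉ S → (∏ y ∈ S, (q' y : ℝ)) = ∏ y ∈ S, (q y : ℝ) := fun S hS =>
    Finset.prod_congr rfl fun y hy => by rw [hq' y (fun h => hS (h ▸ hy))]
  refine ⟨by rw [hP' a hab, hprod (P a) hba], fun z hz => ?_⟩
  by_cases hzb : z = b
  · subst hzb; rw [hP'b, hq'T]
  · rw [hP' z hzb, hprod (P z) (comb_hair_tip_notMem P a A hbA hba hbb hA6 hz hzb)]

omit [Fintype ι] in
/-- The number of hairs attached at a positive level drops by one. [this work] -/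
theorem comb_top_measure (P P' : ι → Finset ι) (a : ι) (A : Finset ι) {b : ι} (hbA : b ∈ A) (hba : b ∉ P a) (hbb : b ∈ P b)
    (hP'b : P' b = P b \ P a) (hP' : ∀ x, x ≠ b → P' x = P x) :
    A.filter (fun z => ¬ P' z ⊆ P' a ∧ (P' z ∩ P' a).Nonempty) =
      (A.filter fun z => ¬ P z ⊆ P a ∧ (P z ∩ P a).Nonempty).erase b := by
  have hab : a ≠ b := fun h => hba (by rw [h]; exact hbb)
  have hP'a : P' a = P a := hP' a hab
  ext z
  rw [Finset.mem_erase, Finset.mem_filter, Finset.mem_filter]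
  constructor
  · rintro ⟨hz, h1, h2⟩
    have hzb : z ≠ b := by
      rintro rfl
      rw [hP'b, hP'a] at h2
      obtain ⟨y, hy⟩ := h2
      rw [Finset.mem_inter, Finset.mem_sdiff] at hy
      exact hy.1.2 hy.2
    rw [hP' z hzb, hP'a] at h1 h2
    exact ⟨hzb, hz, h1, h2⟩
  · rintro ⟨hzb, hz, h1, h2⟩
    rw [hP' z hzb, hP'a]
    exact ⟨hz, h1, h2⟩

end Quant

end Summit.CriticalPhenomena.PercolationContinuityZ3.Theorems

end
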